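import Literature.NumberTheory.Automorphic.AutomorphicRepsGLCuspidalL2Step1Garding
import Literature.NumberTheory.Automorphic.ArchUnipotentConvTestFunction
import HarnessLib

/-!
# The archimedean derivative of a test-function weight through its left archimedean slice

Topic `NumberTheory/Automorphic`; namespace `Literature.NumberTheory.Automorphic`. Proof file
(theorems only). For a test function `θ` on `GL_n(𝔸_K)` (`IsTestFunctionGL`), the archimedean left
derivative `θ_X = derivWeight ι X θ` of `AutomorphicRepsGLCuspidalL2Step1`
(`θ_X(h) = d/dt θ((exp tX, 1)⁻¹ h)|₀`, `ι` the archimedean embedding of the `GL_n` datum) is read on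
the smooth left archimedean slice `leftArchSlice θ h : M_n(K_∞) → ℝ`, `m ↦ θ((m,1) h)`
(`TestFunctionGLArchSlice`):

* `derivWeight_eq_fderiv_leftArchSlice` — **`θ_X(h) = D(leftArchSlice θ h)(1)(-X)`**; hence
  `θ_X` is `ℝ`-linear in `X` (`derivWeight_add_lie`, `derivWeight_smul_lie`);
* `leftArchSlice_leftTranslateWeight` — the slice of a left translate:
  `leftArchSlice (L_g θ) h (m) = leftArchSlice θ (g⁻¹ h) (g_∞⁻¹ m g_∞)`;
* `derivWeight_leftTranslateWeight` — **the derivative of a left translate**: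
  `(L_g θ)_X = L_g (θ_{Ad(g_∞⁻¹) X})` (chain rule with the conjugation by `g_∞⁻¹`).

These are the first identities of the commutation calculus for the Kirillov `L²`-bound
(Jacquet–Shalika (1981), §3–§4; Bump (1997), (2.28)–(2.29)).

## References

* D. Bump, *Automorphic Forms and Representations* (1997), §2.2, (2.28)–(2.29) [Bump1997].
* H. Jacquet, J. A. Shalika, *On Euler products and the classification of automorphic
  representations I*, Amer. J. Math. 103 (1981), §3–§4 [JacquetShalikaAJM1981].
-/

noncomputable section

open scoped MatrixGroups Classical ContDiff
open NumberField NumberField.mixedEmbedding IsDedekindDomain MeasureTheory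

namespace Literature.NumberTheory.Automorphic

variable {n : ℕ} {K : Type} [Field K] [NumberField K]
  (hcpt : isCompact_glFiniteIntegralLevel n K)

set_option backward.isDefEq.respectTransparency false

attribute [local instance 100] LieRing.ofAssociativeRing

open scoped Matrix.Norms.Operator

/-! ### The derivative through the slice -/

/-- The left translate by the archimedean exponential, read on the slice:
`θ((exp tX, 1)⁻¹ h) = leftArchSlice θ h (exp(-tX))`. [folklore] -/
theorem weight_ofArch_expMem_inv_mul (θ : GL (Fin n) (AdeleRing (𝓞 K) K) → ℝ)
    (X : (AutomorphyDatum.gl n K hcpt).arch.lie) (t : ℝ) (h : (AdelicGroupData.gl n K).Adelic) :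
    θ (((AutomorphyDatum.gl n K hcpt).ofArch ((AutomorphyDatum.gl n K hcpt).arch.expMem (t • X)))⁻¹ * h) =
      leftArchSlice θ h (NormedSpace.exp (-(t • (X : Matrix (Fin n) (Fin n) (mixedSpace K)))) * 1) := by
  rw [mul_one, expMem_smul_eq_expArch, ← map_inv, AutomorphyDatum.gl_ofArch_apply, Subgroup.coe_inv, coe_expArch,
    ← expGL_neg, ← coe_expGL, leftArchSlice_coe]

/-- **The archimedean derivative through the slice**: `θ_X(h) = D(leftArchSlice θ h)(1)(-X)` for a
test function `θ`. [cite: Bump1997, (2.29) (PDF p. 279)] -/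
theorem derivWeight_eq_fderiv_leftArchSlice {θ : GL (Fin n) (AdeleRing (𝓞 K) K) → ℝ}
    (hθ : IsTestFunctionGL n K θ) (X : (AutomorphyDatum.gl n K hcpt).arch.lie)
    (h : (AdelicGroupData.gl n K).Adelic) :
    derivWeight (AutomorphyDatum.gl n K hcpt).ofArch X θ h =
      fderiv ℝ (leftArchSlice θ h) 1 (-(X : Matrix (Fin n) (Fin n) (mixedSpace K))) := by
  have hd := hasDerivAt_comp_exp_neg_smul (hθ.contDiff_leftArchSlice h)
    (X : Matrix (Fin n) (Fin n) (mixedSpace K)) 1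
  have heq : (fun t : ℝ => θ (((AutomorphyDatum.gl n K hcpt).ofArch
      ((AutomorphyDatum.gl n K hcpt).arch.expMem (t • X)))⁻¹ * h)) =
      fun t : ℝ => leftArchSlice θ h (NormedSpace.exp (-(t • (X : Matrix (Fin n) (Fin n) (mixedSpace K)))) * 1) := by
    funext t
    exact weight_ofArch_expMem_inv_mul hcpt θ X t h
  unfold derivWeight
  rw [heq, hd.deriv, derivFactor, mul_one]

/-- **Additivity in `X`**: `θ_{X+Y} = θ_X + θ_Y` for a test function `θ`. [folklore] -/
theorem derivWeight_add_lie {θ : GL (Fin n) (AdeleRing (𝓞 K) K) → ℝ} (hθ : IsTestFunctionGL n K θ)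
    (X Y : (AutomorphyDatum.gl n K hcpt).arch.lie) :
    derivWeight (AutomorphyDatum.gl n K hcpt).ofArch (X + Y) θ =
      derivWeight (AutomorphyDatum.gl n K hcpt).ofArch X θ + derivWeight (AutomorphyDatum.gl n K hcpt).ofArch Y θ := by
  funext h
  have hc : ((X + Y : (AutomorphyDatum.gl n K hcpt).arch.lie) : Matrix (Fin n) (Fin n) (mixedSpace K)) =
      (X : Matrix (Fin n) (Fin n) (mixedSpace K)) + Y := rfl
  rw [Pi.add_apply, derivWeight_eq_fderiv_leftArchSlice hcpt hθ, derivWeight_eq_fderiv_leftArchSlice hcpt hθ,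
    derivWeight_eq_fderiv_leftArchSlice hcpt hθ, hc, neg_add, map_add]

/-- **Homogeneity in `X`**: `θ_{cX} = c θ_X` for a test function `θ`. [folklore] -/
theorem derivWeight_smul_lie {θ : GL (Fin n) (AdeleRing (𝓞 K) K) → ℝ} (hθ : IsTestFunctionGL n K θ)
    (c : ℝ) (X : (AutomorphyDatum.gl n K hcpt).arch.lie) :
    derivWeight (AutomorphyDatum.gl n K hcpt).ofArch (c • X) θ =
      c • derivWeight (AutomorphyDatum.gl n K hcpt).ofArch X θ := by
  funext h
  have hc : ((c • X : (AutomorphyDatum.gl n K hcpt).arch.lie) : Matrix (Fin n) (Fin n) (mixedSpace K)) =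
      c • (X : Matrix (Fin n) (Fin n) (mixedSpace K)) := rfl
  rw [Pi.smul_apply, derivWeight_eq_fderiv_leftArchSlice hcpt hθ, derivWeight_eq_fderiv_leftArchSlice hcpt hθ, hc,
    ← smul_neg, map_smul]

/-- **Finite sums in `X`**. [folklore] -/
theorem derivWeight_sum_lie {θ : GL (Fin n) (AdeleRing (𝓞 K) K) → ℝ} (hθ : IsTestFunctionGL n K θ)
    {ι' : Type*} (s : Finset ι') (c : ι' → ℝ) (X : ι' → (AutomorphyDatum.gl n K hcpt).arch.lie) :
    derivWeight (AutomorphyDatum.gl n K hcpt).ofArch (∑ i ∈ s, c i • X i) θ =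
      ∑ i ∈ s, c i • derivWeight (AutomorphyDatum.gl n K hcpt).ofArch (X i) θ := by
  induction s using Finset.induction_on with
  | empty =>
    funext h
    simp only [Finset.sum_empty, Pi.zero_apply]
    rw [derivWeight_eq_fderiv_leftArchSlice hcpt hθ]
    simp
  | insert i s hi ih =>
    rw [Finset.sum_insert hi, Finset.sum_insert hi, derivWeight_add_lie hcpt hθ, derivWeight_smul_lie hcpt hθ, ih]

/-! ### The slice and the derivative of a left translate -/

/-- Conjugation by the archimedean component `c = g_∞`, as a continuous linear map of `M_n(K_∞)`:
`m ↦ c⁻¹ m c`. [folklore] -/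
def archConjCLM (c : GL (Fin n) (mixedSpace K)) :
    Matrix (Fin n) (Fin n) (mixedSpace K) →L[ℝ] Matrix (Fin n) (Fin n) (mixedSpace K) :=
  { toFun := fun m => ((c⁻¹ : GL (Fin n) (mixedSpace K)) : Matrix (Fin n) (Fin n) (mixedSpace K)) * m *
      (c : Matrix (Fin n) (Fin n) (mixedSpace K))
    map_add' := fun a b => by rw [mul_add, add_mul]
    map_smul' := fun r a => by rw [mul_smul_comm, smul_mul_assoc, RingHom.id_apply]
    cont := ((continuous_const.mul continuous_id).mul continuous_const) }

omit [NumberField K] in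
/-- Unfolding of `archConjCLM`. [folklore] -/
@[simp]
theorem archConjCLM_apply (c : GL (Fin n) (mixedSpace K)) (m : Matrix (Fin n) (Fin n) (mixedSpace K)) :
    archConjCLM c m = ((c⁻¹ : GL (Fin n) (mixedSpace K)) : Matrix (Fin n) (Fin n) (mixedSpace K)) * m *
      (c : Matrix (Fin n) (Fin n) (mixedSpace K)) := rfl

/-- **The slice of a left translate**: `leftArchSlice (L_g θ) h m = leftArchSlice θ (g⁻¹ h) (g_∞⁻¹ m g_∞)`
(`x⁻¹ (w, 1) x = (x_∞⁻¹ w x_∞, 1)`; both sides vanish at non-invertible `m`). [folklore] -/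
theorem leftArchSlice_leftTranslateWeight (θ : GL (Fin n) (AdeleRing (𝓞 K) K) → ℝ)
    (g h : GL (Fin n) (AdeleRing (𝓞 K) K)) (m : Matrix (Fin n) (Fin n) (mixedSpace K)) :
    leftArchSlice (leftTranslateWeight (n := n) g θ) h m =
      leftArchSlice θ (g⁻¹ * h) (archConjCLM (GLn.toMixed n K g) m) := by
  by_cases hm : IsUnit m
  · obtain ⟨u, rfl⟩ := hm
    have hu' : archConjCLM (GLn.toMixed n K g) (u : Matrix (Fin n) (Fin n) (mixedSpace K)) =
        (((GLn.toMixed n K g)⁻¹ * u * GLn.toMixed n K g : GL (Fin n) (mixedSpace K)) :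
          Matrix (Fin n) (Fin n) (mixedSpace K)) := by
      simp only [archConjCLM_apply, Units.val_mul]
    rw [hu', leftArchSlice_coe, leftArchSlice_coe, leftTranslateWeight_apply, ← GLn.inv_mul_ofInfinite_mul]
    show θ (g⁻¹ * (GLn.ofInfinite n K u * h)) = θ (g⁻¹ * GLn.ofInfinite n K u * g * (g⁻¹ * h))
    congr 1
    simp only [mul_assoc, mul_inv_cancel_left]
  · have hm' : ¬IsUnit (archConjCLM (GLn.toMixed n K g) m) := by
      intro hu
      apply hm
      have : m = ((GLn.toMixed n K g : GL (Fin n) (mixedSpace K)) : Matrix (Fin n) (Fin n) (mixedSpace K)) *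
          archConjCLM (GLn.toMixed n K g) m *
          (((GLn.toMixed n K g)⁻¹ : GL (Fin n) (mixedSpace K)) : Matrix (Fin n) (Fin n) (mixedSpace K)) := by
        simp only [archConjCLM_apply, ← mul_assoc, Units.mul_inv, one_mul]
        rw [mul_assoc, Units.mul_inv, mul_one]
      rw [this]
      exact ((GLn.toMixed n K g).isUnit.mul hu).mul (GLn.toMixed n K g)⁻¹.isUnit
    rw [leftArchSlice_of_not_isUnit hm, leftArchSlice_of_not_isUnit hm']

/-- The conjugate `Ad(c⁻¹) X = c⁻¹ X c` as an element of `𝔤 = M_n(K_∞)`. [folklore] -/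
def adInvLie (c : GL (Fin n) (mixedSpace K)) (X : (AutomorphyDatum.gl n K hcpt).arch.lie) :
    (AutomorphyDatum.gl n K hcpt).arch.lie :=
  ⟨archConjCLM c (X : Matrix (Fin n) (Fin n) (mixedSpace K)), mem_gl_arch_lie hcpt _⟩

/-- Unfolding of `adInvLie`. [folklore] -/
@[simp]
theorem coe_adInvLie (c : GL (Fin n) (mixedSpace K)) (X : (AutomorphyDatum.gl n K hcpt).arch.lie) :
    (adInvLie hcpt c X : Matrix (Fin n) (Fin n) (mixedSpace K)) =
      ((c⁻¹ : GL (Fin n) (mixedSpace K)) : Matrix (Fin n) (Fin n) (mixedSpace K)) * X *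
        (c : Matrix (Fin n) (Fin n) (mixedSpace K)) := rfl

/-- **The derivative of a left translate**: `(L_g θ)_X = L_g (θ_{Ad(g_∞⁻¹) X})` for a test function
`θ`. [cite: Bump1997, (2.29) (PDF p. 279)] -/
theorem derivWeight_leftTranslateWeight {θ : GL (Fin n) (AdeleRing (𝓞 K) K) → ℝ} (hθ : IsTestFunctionGL n K θ)
    (X : (AutomorphyDatum.gl n K hcpt).arch.lie) (g : (AdelicGroupData.gl n K).Adelic) :
    derivWeight (AutomorphyDatum.gl n K hcpt).ofArch X (leftTranslateWeight (n := n) g θ) =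
      leftTranslateWeight (n := n) g (derivWeight (AutomorphyDatum.gl n K hcpt).ofArch (adInvLie hcpt (GLn.toMixed n K g) X) θ) := by
  funext h
  rw [leftTranslateWeight_apply, derivWeight_eq_fderiv_leftArchSlice hcpt (hθ.leftTranslate g),
    derivWeight_eq_fderiv_leftArchSlice hcpt hθ]
  -- the slice of the translate is the slice of `θ` composed with the conjugation CLM
  have hcomp : leftArchSlice (leftTranslateWeight (n := n) g θ) h =
      leftArchSlice θ (g⁻¹ * h) ∘ archConjCLM (GLn.toMixed n K g) := by
    funext m
    exact leftArchSlice_leftTranslateWeight θ g h m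
  rw [hcomp, (((hθ.contDiff_leftArchSlice (g⁻¹ * h)).differentiable (by simp)) _).hasFDerivAt.comp 1
    (archConjCLM (GLn.toMixed n K g)).hasFDerivAt |>.fderiv]
  simp only [ContinuousLinearMap.coe_comp, Function.comp_apply, map_neg, coe_adInvLie, archConjCLM_apply, mul_one,
    Units.inv_mul]

end Literature.NumberTheory.Automorphic
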